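import Mathlib.Analysis.Calculus.LineDeriv.Basic
import Mathlib.Analysis.Calculus.FDeriv.Symmetric
import Mathlib.Analysis.Calculus.Deriv.Inv
import Mathlib.Analysis.Calculus.Deriv.Pow
import Mathlib.Analysis.Calculus.Deriv.Prod
import Mathlib.Analysis.Calculus.Deriv.Mul
import Summits.AtomisticToContinuum.Crystallization.Theorems.FreeSplittingCertificatesStrictSplittingRuleFarPencilPointwise

/-!
# `StrictSplittingRule` (stmt-AtomisticToContinuum-12560): the far-pencil flux IS a divergence — calculus of `fpDivFlux`

Route `FreeSplittingCertificates`, crux r3 `StrictSplittingRule` (H12⋆ = `stub_coreJointCoercive`), unit b2b-freesplit-B gen 10.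
VALUE = the calculus step that `…FarPencilPointwise.lean` recorded in prose only, now a tree theorem — NOT a proof of H12⋆, NOT
summit progress.

`…FarPencilPointwise.lean` proves the pointwise polynomial identity `(17/200)·Den − Num − (1/18)·fpDivFlux = |x|⁻¹²·SOS ≥ 0` in the
free variables `(x, v, G)`, and SAYS that `fpDivFlux x (v x) (∇v x)` is the divergence of the flux
`Φ(x) = |x|⁻⁸|v|²x + 7|x|⁻⁸⟪x,v⟫v + |x|⁻⁶((v·∇)v − (div v)v)`.  Here we prove exactly that, for an honest vector field
`v : ℝ³ → ℝ³` (`Fin 3 → ℝ`-valued functions on `Fin 3 → ℝ`):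
* `fpGrad v x i j = ∂ᵢvⱼ(x)` (`= fderiv ℝ v x eᵢ j`), `fpHess v x k i j = ∂ₖ∂ᵢvⱼ(x)`, the flux `fpFlux v x j = Φⱼ(x)` built from
  `v x` and `fpGrad v x`, and the explicit directional derivative `fpFluxDeriv v x j k` of `Φⱼ` along `eₖ`;
* `hasLineDerivAt_fpFlux`: at every `x ≠ 0` where `v` is differentiable and `fderiv ℝ v` is differentiable,
  `HasLineDerivAt ℝ (Φⱼ) (fpFluxDeriv v x j k) x eₖ` (product rule, chain rule along the coordinate line);
* `sum_fpFluxDeriv_eq`: `Σⱼ fpFluxDeriv v x j j = fpDivFlux x (v x) (fpGrad v x) + |x|⁻⁶·Σᵢⱼ vᵢ(∂ⱼ∂ᵢvⱼ − ∂ᵢ∂ⱼvⱼ)` (`ring`), and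
  `sum_fpFluxDeriv_eq_fpDivFlux`: the last sum vanishes when the second derivative is symmetric — in particular
  (`sum_fpFluxDeriv_eq_fpDivFlux_of_contDiffAt`) when `v` is `C²` at `x` — so that **`div Φ = fpDivFlux`** holds on the nose;
* `fpFlux_eq_zero`, `fpFluxDeriv_eq_zero`: both vanish where `v`, `∇v` (and `∇²v`) vanish (used off the support of `v`).
The integration (`∫ div Φ = 0` for compactly supported fields, hence `∫ Num ≤ (17/200)∫ Den`) is the companion file
`…FarPencilIntegral.lean`.  HONEST FRAMING: multivariable calculus about an explicit flux; NOT a proof of H12⋆, NOT summit progress.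
-/

noncomputable section

namespace Summit.AtomisticToContinuum.Crystallization.Theorems.StrictSplittingRuleBirth

/-! ## Objects -/

/-- The coordinate vector `eₖ`. -/
def fpE (k : Fin 3) : Fin 3 → ℝ := Pi.single k 1

/-- `(eₖ)ₖ = 1`. -/
@[simp] theorem fpE_apply_same (k : Fin 3) : fpE k k = 1 := by simp [fpE]

/-- `(eₖ)ⱼ = 0` for `j ≠ k`. -/
theorem fpE_apply_of_ne {k j : Fin 3} (h : j ≠ k) : fpE k j = 0 := by simp [fpE, h]

/-- The gradient matrix of a vector field: `fpGrad v x i j = ∂ᵢ vⱼ (x) = fderiv ℝ v x eᵢ j`. -/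
def fpGrad (v : (Fin 3 → ℝ) → (Fin 3 → ℝ)) (x : Fin 3 → ℝ) : Fin 3 → Fin 3 → ℝ :=
  fun i j => fderiv ℝ v x (fpE i) j

/-- Second derivatives: `fpHess v x k i j = ∂ₖ ∂ᵢ vⱼ (x) = fderiv ℝ (fderiv ℝ v) x eₖ eᵢ j`. -/
def fpHess (v : (Fin 3 → ℝ) → (Fin 3 → ℝ)) (x : Fin 3 → ℝ) : Fin 3 → Fin 3 → Fin 3 → ℝ :=
  fun k i j => fderiv ℝ (fderiv ℝ v) x (fpE k) (fpE i) j

/-- The flux `Φⱼ(y) = |y|⁻⁸(|v|²yⱼ + 7⟪y,v⟫vⱼ) + |y|⁻⁶(Σᵢ vᵢ∂ᵢvⱼ − (div v)vⱼ)` of `…FarPencilPointwise`, as a function of the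
field `v` (with `|y|⁻² = (fpSq y)⁻¹`, so that `Φ(0) = 0` by `0⁻¹ = 0`). -/
def fpFlux (v : (Fin 3 → ℝ) → (Fin 3 → ℝ)) (y : Fin 3 → ℝ) (j : Fin 3) : ℝ :=
  (fpSq y)⁻¹ ^ 4 * (fpSq (v y) * y j + 7 * fpDot y (v y) * v y j) +
    (fpSq y)⁻¹ ^ 3 *
      (v y 0 * fpGrad v y 0 j + v y 1 * fpGrad v y 1 j + v y 2 * fpGrad v y 2 j - fpTr (fpGrad v y) * v y j)

/-- The directional derivative `∂ₖΦⱼ(x)` written out by the product rule in terms of `x`, `v x`, `G = fpGrad v x`,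
`H = fpHess v x` (`∂ₖ|x|² = 2⟪x,eₖ⟫`, `∂ₖ(|x|⁻²)⁴ = −8⟪x,eₖ⟫|x|⁻¹⁰`, `∂ₖ(|x|⁻²)³ = −6⟪x,eₖ⟫|x|⁻⁸`, `∂ₖxⱼ = (eₖ)ⱼ`,
`∂ₖvⱼ = Gₖⱼ`, `∂ₖGᵢⱼ = Hₖᵢⱼ`). -/
def fpFluxDeriv (v : (Fin 3 → ℝ) → (Fin 3 → ℝ)) (x : Fin 3 → ℝ) (j k : Fin 3) : ℝ :=
  -8 * fpDot x (fpE k) * (fpSq x)⁻¹ ^ 5 * (fpSq (v x) * x j + 7 * fpDot x (v x) * v x j) +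
    (fpSq x)⁻¹ ^ 4 *
      (2 * (v x 0 * fpGrad v x k 0 + v x 1 * fpGrad v x k 1 + v x 2 * fpGrad v x k 2) * x j +
        fpSq (v x) * fpE k j +
        7 * (fpDot (fpE k) (v x) + (x 0 * fpGrad v x k 0 + x 1 * fpGrad v x k 1 + x 2 * fpGrad v x k 2)) * v x j +
        7 * fpDot x (v x) * fpGrad v x k j) -
    6 * fpDot x (fpE k) * (fpSq x)⁻¹ ^ 4 *
      (v x 0 * fpGrad v x 0 j + v x 1 * fpGrad v x 1 j + v x 2 * fpGrad v x 2 j - fpTr (fpGrad v x) * v x j) +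
    (fpSq x)⁻¹ ^ 3 *
      (fpGrad v x k 0 * fpGrad v x 0 j + fpGrad v x k 1 * fpGrad v x 1 j + fpGrad v x k 2 * fpGrad v x 2 j +
        (v x 0 * fpHess v x k 0 j + v x 1 * fpHess v x k 1 j + v x 2 * fpHess v x k 2 j) -
        (fpHess v x k 0 0 + fpHess v x k 1 1 + fpHess v x k 2 2) * v x j -
        fpTr (fpGrad v x) * fpGrad v x k j)

/-! ## Algebra of the trace: `Σⱼ ∂ⱼΦⱼ = fpDivFlux + |x|⁻⁶ Σᵢⱼ vᵢ(Hⱼᵢⱼ − Hᵢⱼⱼ)` -/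

/-- `|x|² ≠ 0` for `x ≠ 0`. -/
theorem fpSq_ne_zero {x : Fin 3 → ℝ} (hx : x ≠ 0) : fpSq x ≠ 0 := fun h => hx ((fpSq_eq_zero_iff x).1 h)

/-- `|x + t e|² = |x|² + 2t⟪x,e⟫ + t²|e|²`. -/
theorem fpSq_add_smul (x e : Fin 3 → ℝ) (t : ℝ) :
    fpSq (x + t • e) = fpSq x + 2 * fpDot x e * t + fpSq e * t ^ 2 := by
  simp only [fpSq, fpDot, Pi.add_apply, Pi.smul_apply, smul_eq_mul]
  ring

/-- **Trace of the flux derivative** (pure algebra, any `x ≠ 0`): `Σⱼ fpFluxDeriv v x j j` equals `fpDivFlux x (v x) (∇v x)` plus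
the commutator of second derivatives `|x|⁻⁶ Σᵢⱼ vᵢ (∂ⱼ∂ᵢvⱼ − ∂ᵢ∂ⱼvⱼ)`. -/
theorem sum_fpFluxDeriv_eq (v : (Fin 3 → ℝ) → (Fin 3 → ℝ)) {x : Fin 3 → ℝ} (hx : x ≠ 0) :
    fpFluxDeriv v x 0 0 + fpFluxDeriv v x 1 1 + fpFluxDeriv v x 2 2 =
      fpDivFlux x (v x) (fpGrad v x) +
        (fpSq x)⁻¹ ^ 3 * ∑ i : Fin 3, ∑ j : Fin 3, v x i * (fpHess v x j i j - fpHess v x i j j) := by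
  have hρ : fpSq x ≠ 0 := fpSq_ne_zero hx
  have h10 : fpE (1 : Fin 3) 0 = 0 := fpE_apply_of_ne (by decide)
  have h20 : fpE (2 : Fin 3) 0 = 0 := fpE_apply_of_ne (by decide)
  have h01 : fpE (0 : Fin 3) 1 = 0 := fpE_apply_of_ne (by decide)
  have h21 : fpE (2 : Fin 3) 1 = 0 := fpE_apply_of_ne (by decide)
  have h02 : fpE (0 : Fin 3) 2 = 0 := fpE_apply_of_ne (by decide)
  have h12 : fpE (1 : Fin 3) 2 = 0 := fpE_apply_of_ne (by decide)
  simp only [fpFluxDeriv, fpDivFlux, Fin.sum_univ_three, fpDot, fpTr, fpTrSq, fpXGV, fpVGX, fpE_apply_same,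
    h10, h20, h01, h21, h02, h12]
  have hu : (fpSq x)⁻¹ * fpSq x = 1 := inv_mul_cancel₀ hρ
  have hS : fpSq x = x 0 ^ 2 + x 1 ^ 2 + x 2 ^ 2 := rfl
  have hSv : fpSq (v x) = v x 0 ^ 2 + v x 1 ^ 2 + v x 2 ^ 2 := rfl
  rw [hSv]
  -- `u⁵·|x|² = u⁴` is the only non-polynomial step
  have key : (fpSq x)⁻¹ ^ 5 * (x 0 * x 0 + x 1 * x 1 + x 2 * x 2) = (fpSq x)⁻¹ ^ 4 := by
    have : x 0 * x 0 + x 1 * x 1 + x 2 * x 2 = fpSq x := by rw [hS]; ring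
    rw [this, pow_succ, mul_assoc, hu, mul_one]
  linear_combination (-8 * (v x 0 ^ 2 + v x 1 ^ 2 + v x 2 ^ 2)) * key

/-- If the second derivative is symmetric (`Hₖᵢⱼ = Hᵢₖⱼ`), the trace of the flux derivative IS `fpDivFlux`. -/
theorem sum_fpFluxDeriv_eq_fpDivFlux (v : (Fin 3 → ℝ) → (Fin 3 → ℝ)) {x : Fin 3 → ℝ} (hx : x ≠ 0)
    (hsymm : ∀ k i j, fpHess v x k i j = fpHess v x i k j) :
    fpFluxDeriv v x 0 0 + fpFluxDeriv v x 1 1 + fpFluxDeriv v x 2 2 = fpDivFlux x (v x) (fpGrad v x) := by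
  rw [sum_fpFluxDeriv_eq v hx]
  have : ∑ i : Fin 3, ∑ j : Fin 3, v x i * (fpHess v x j i j - fpHess v x i j j) = 0 := by
    refine Finset.sum_eq_zero fun i _ => Finset.sum_eq_zero fun j _ => ?_
    rw [hsymm j i j, sub_self, mul_zero]
  rw [this, mul_zero, add_zero]

/-- The symmetry hypothesis holds wherever `v` is `C²` (Schwarz/Clairaut, `ContDiffAt.isSymmSndFDerivAt`). -/
theorem fpHess_symm_of_contDiffAt {v : (Fin 3 → ℝ) → (Fin 3 → ℝ)} {x : Fin 3 → ℝ} (hv : ContDiffAt ℝ 2 v x)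
    (k i j : Fin 3) : fpHess v x k i j = fpHess v x i k j := by
  have h := hv.isSymmSndFDerivAt (by simp)
  simp only [fpHess]
  rw [h.eq (fpE k) (fpE i)]

/-- `div Φ = fpDivFlux` at every `x ≠ 0` where `v` is `C²`. -/
theorem sum_fpFluxDeriv_eq_fpDivFlux_of_contDiffAt (v : (Fin 3 → ℝ) → (Fin 3 → ℝ)) {x : Fin 3 → ℝ} (hx : x ≠ 0)
    (hv : ContDiffAt ℝ 2 v x) :
    fpFluxDeriv v x 0 0 + fpFluxDeriv v x 1 1 + fpFluxDeriv v x 2 2 = fpDivFlux x (v x) (fpGrad v x) :=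
  sum_fpFluxDeriv_eq_fpDivFlux v hx (fpHess_symm_of_contDiffAt hv)

/-! ## Calculus: `∂ₖΦⱼ = fpFluxDeriv` -/

/-- The coordinate line `t ↦ x + t eₖ` has velocity `eₖ`. -/
theorem hasDerivAt_fpLine (x e : Fin 3 → ℝ) : HasDerivAt (fun t : ℝ => x + t • e) e 0 := by
  simpa using ((hasDerivAt_id (0 : ℝ)).smul_const e).const_add x

/-- Coordinates along the line: `d/dt (x + t e)ⱼ = eⱼ`. -/
theorem hasDerivAt_fpLine_apply (x e : Fin 3 → ℝ) (j : Fin 3) :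
    HasDerivAt (fun t : ℝ => (x + t • e) j) (e j) 0 :=
  (hasDerivAt_pi.1 (hasDerivAt_fpLine x e)) j

/-- `d/dt |x + t e|² = 2⟪x,e⟫` at `t = 0`. -/
theorem hasDerivAt_fpSq_line (x e : Fin 3 → ℝ) :
    HasDerivAt (fun t : ℝ => fpSq (x + t • e)) (2 * fpDot x e) 0 := by
  have h : HasDerivAt (fun t : ℝ => fpSq x + 2 * fpDot x e * t + fpSq e * t ^ 2)
      (0 + 2 * fpDot x e * 1 + fpSq e * (↑2 * (0 : ℝ) ^ (2 - 1) * 1)) 0 :=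
    ((hasDerivAt_const (0 : ℝ) (fpSq x)).add ((hasDerivAt_id (0 : ℝ)).const_mul _)).add
      (((hasDerivAt_id (0 : ℝ)).pow 2).const_mul _)
  have h' : HasDerivAt (fun t : ℝ => fpSq x + 2 * fpDot x e * t + fpSq e * t ^ 2) (2 * fpDot x e) 0 :=
    h.congr_deriv (by norm_num)
  refine h'.congr_of_eventuallyEq (Filter.Eventually.of_forall fun t => ?_)
  exact fpSq_add_smul x e t

/-- `d/dt |x + t e|⁻² = −2⟪x,e⟫|x|⁻⁴` at `t = 0` (`x ≠ 0`). -/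
theorem hasDerivAt_fpSq_inv_line {x : Fin 3 → ℝ} (hx : x ≠ 0) (e : Fin 3 → ℝ) :
    HasDerivAt (fun t : ℝ => (fpSq (x + t • e))⁻¹) (-(2 * fpDot x e) * (fpSq x)⁻¹ ^ 2) 0 := by
  have h0 : fpSq (x + (0 : ℝ) • e) ≠ 0 := by simpa using fpSq_ne_zero hx
  refine ((hasDerivAt_fpSq_line x e).inv h0).congr_deriv ?_
  simp only [zero_smul, add_zero]
  rw [div_eq_mul_inv, inv_pow]

/-- The field along the line: `d/dt vₘ(x + t eₖ) = Gₖₘ`. -/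
theorem hasDerivAt_fpField_line {v : (Fin 3 → ℝ) → (Fin 3 → ℝ)} {x : Fin 3 → ℝ} (hv : DifferentiableAt ℝ v x)
    (k m : Fin 3) : HasDerivAt (fun t : ℝ => v (x + t • fpE k) m) (fpGrad v x k m) 0 := by
  have h : HasDerivAt (v ∘ fun t : ℝ => x + t • fpE k) (fderiv ℝ v x (fpE k)) 0 :=
    hv.hasFDerivAt.comp_hasDerivAt_of_eq (0 : ℝ) (hasDerivAt_fpLine x (fpE k)) (by simp)
  exact (hasDerivAt_pi.1 h) m

/-- The gradient along the line: `d/dt Gᵢₘ(x + t eₖ) = Hₖᵢₘ`. -/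
theorem hasDerivAt_fpGrad_line {v : (Fin 3 → ℝ) → (Fin 3 → ℝ)} {x : Fin 3 → ℝ}
    (hv2 : DifferentiableAt ℝ (fderiv ℝ v) x) (k i m : Fin 3) :
    HasDerivAt (fun t : ℝ => fpGrad v (x + t • fpE k) i m) (fpHess v x k i m) 0 := by
  have hc : HasDerivAt ((fderiv ℝ v) ∘ fun t : ℝ => x + t • fpE k) (fderiv ℝ (fderiv ℝ v) x (fpE k)) 0 :=
    hv2.hasFDerivAt.comp_hasDerivAt_of_eq (0 : ℝ) (hasDerivAt_fpLine x (fpE k)) (by simp)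
  have h := hc.clm_apply (hasDerivAt_const (0 : ℝ) (fpE i))
  have h' : HasDerivAt (fun t : ℝ => fderiv ℝ v (x + t • fpE k) (fpE i)) (fderiv ℝ (fderiv ℝ v) x (fpE k) (fpE i)) 0 := by
    refine h.congr_deriv ?_
    simp
  exact (hasDerivAt_pi.1 h') m

/-- **The flux has the stated directional derivatives**: at every `x ≠ 0` where `v` and `∇v` are differentiable,
`∂ₖΦⱼ(x) = fpFluxDeriv v x j k` as a line derivative along `eₖ`. -/
theorem hasLineDerivAt_fpFlux {v : (Fin 3 → ℝ) → (Fin 3 → ℝ)} {x : Fin 3 → ℝ} (hx : x ≠ 0)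
    (hv : DifferentiableAt ℝ v x) (hv2 : DifferentiableAt ℝ (fderiv ℝ v) x) (j k : Fin 3) :
    HasLineDerivAt ℝ (fun y => fpFlux v y j) (fpFluxDeriv v x j k) x (fpE k) := by
  have hX := hasDerivAt_fpLine_apply x (fpE k)
  have hV := hasDerivAt_fpField_line hv k
  have hG := hasDerivAt_fpGrad_line hv2 k
  have hu := hasDerivAt_fpSq_inv_line hx (fpE k)
  -- |v|² and ⟪x,v⟫ along the line
  have hS : HasDerivAt (fun t : ℝ => fpSq (v (x + t • fpE k)))
      (2 * (v x 0 * fpGrad v x k 0 + v x 1 * fpGrad v x k 1 + v x 2 * fpGrad v x k 2)) 0 := by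
    have h := (((hV 0).pow 2).add ((hV 1).pow 2)).add ((hV 2).pow 2)
    refine (h.congr_deriv ?_).congr_of_eventuallyEq (Filter.Eventually.of_forall fun t => rfl)
    simp only [zero_smul, add_zero]
    norm_num
    ring
  have hD : HasDerivAt (fun t : ℝ => fpDot (x + t • fpE k) (v (x + t • fpE k)))
      (fpDot (fpE k) (v x) + (x 0 * fpGrad v x k 0 + x 1 * fpGrad v x k 1 + x 2 * fpGrad v x k 2)) 0 := by
    have h := (((hX 0).mul (hV 0)).add ((hX 1).mul (hV 1))).add ((hX 2).mul (hV 2))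
    refine (h.congr_deriv ?_).congr_of_eventuallyEq (Filter.Eventually.of_forall fun t => rfl)
    simp only [zero_smul, add_zero, fpDot]
    ring
  have hT : HasDerivAt (fun t : ℝ => fpTr (fpGrad v (x + t • fpE k)))
      (fpHess v x k 0 0 + fpHess v x k 1 1 + fpHess v x k 2 2) 0 :=
    ((hG 0 0).add (hG 1 1)).add (hG 2 2)
  -- the two summands of Φⱼ
  have h1 := (hu.pow 4).mul ((hS.mul (hX j)).add (((hD.const_mul 7).mul (hV j))))
  have h2 := (hu.pow 3).mul
    (((((hV 0).mul (hG 0 j)).add ((hV 1).mul (hG 1 j))).add ((hV 2).mul (hG 2 j))).sub (hT.mul (hV j)))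
  have h := h1.add h2
  refine (h.congr_deriv ?_).congr_of_eventuallyEq (Filter.Eventually.of_forall fun t => rfl)
  simp only [zero_smul, add_zero, fpFluxDeriv]
  norm_num
  ring

/-! ## Off the support -/

/-- The flux vanishes where the field and its gradient vanish. -/
theorem fpFlux_eq_zero {v : (Fin 3 → ℝ) → (Fin 3 → ℝ)} {y : Fin 3 → ℝ} (hv : v y = 0) (hG : fderiv ℝ v y = 0)
    (j : Fin 3) : fpFlux v y j = 0 := by
  simp [fpFlux, fpGrad, hv, hG, fpSq, fpDot, fpTr]

/-- The flux derivative vanishes where the field, its gradient and its second derivative vanish. -/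
theorem fpFluxDeriv_eq_zero {v : (Fin 3 → ℝ) → (Fin 3 → ℝ)} {y : Fin 3 → ℝ} (hv : v y = 0) (hG : fderiv ℝ v y = 0)
    (hH : fderiv ℝ (fderiv ℝ v) y = 0) (j k : Fin 3) : fpFluxDeriv v y j k = 0 := by
  simp [fpFluxDeriv, fpGrad, fpHess, hv, hG, hH, fpSq, fpDot, fpTr]

end Summit.AtomisticToContinuum.Crystallization.Theorems.StrictSplittingRuleBirth
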